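import Mathlib
import Literature.MathematicalPhysics.QuantumFieldTheory.Luscher2010.TrivializingMaps
import Literature.MathematicalPhysics.QuantumFieldTheory.Luscher2010.FlowActionSeries
import Summits.Ventures.LatticeQCDFlow.TrivializingMaps.UniformRadius
import Summits.Ventures.LatticeQCDFlow.TrivializingMaps.Truncation
import Summits.Ventures.LatticeQCDFlow.TrivializingMaps.TruncationDefect
import Summits.Ventures.LatticeQCDFlow.TrivializingMaps.SeriesUniqueness
import Summits.Ventures.LatticeQCDFlow.TrivializingMaps.WilsonGradientBound
import HarnessLib

/-!
# Lüscher's volume-uniform radius at EVERY coupling from the geometric gradient bound (Theorem A)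

HONEST FRAMING: exact (Metropolis-corrected) sampling algorithms for lattice gauge theory; figures of merit
are autocorrelation/cost numbers at stated couplings and volumes; no continuum-physics claim.

Proposed tree file: `Summits/Ventures/LatticeQCDFlow/TrivializingMaps/UniformRadiusAllBeta.lean` (venture
side; namespace `Summit.Ventures.LatticeQCDFlow.TrivializingMaps`). Theorems only; no `sorry`, no new axioms;
nothing is asserted about the conjecture `LuscherGeometricGradientBound` (`Truncation.lean` §6, ours).

`Truncation.lean` proves `luscherUniformRadius_one_of_geometric : LuscherGeometricGradientBound d n →
LuscherUniformRadius d n 1` and its docstring announces the general coupling ("this implies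
`LuscherUniformRadius d n β` with `r = ρ/β`; the case `β = 1` is proved below"). This file proves the
announced statement for EVERY real `β`:

* `isLuscherSeries_zero_smul` — the zero series is a Lüscher series of the zero action `0·S`;
* `luscherUniformRadius_of_geometric : LuscherGeometricGradientBound d n → ∀ β, LuscherUniformRadius d n β`
  with radius `ρ/|β|` for `β ≠ 0` (rescale a series of `β S_W` by `β⁻¹`, `IsLuscherSeries.smul`; the
  gradients scale by `β^{k+1}`, `linkDeriv_const_mul'`; compare with a geometric series) and any radius for
  `β = 0` (every smooth Lüscher series of the zero action has vanishing link gradients on `SU(n)^E`, by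
  uniqueness of gradients `IsLuscherSeries.linkDeriv_eq` against the zero series).

So the venture statement's item C1 (`LuscherUniformRadius d n β` for all `β`, `Statement.lean`) is, for every
`β`, a kernel-checked consequence of the single conjecture `LuscherGeometricGradientBound d n`.
[cite: Luscher2010Trivializing, §4.3 eqs. (4.12)–(4.13), §4.5(b)]
-/

namespace Summit.Ventures.LatticeQCDFlow.TrivializingMaps

open Literature.MathematicalPhysics.QuantumFieldTheory
open Literature.MathematicalPhysics.QuantumFieldTheory.Luscher2010
open scoped Matrix Matrix.Norms.Frobenius ContDiff

section

variable {d n : ℕ}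

/-- The zero series `S̃^{(k)} = 0`, `Ċ^{(k)} = 0` is a Lüscher series of the zero action `W ↦ 0·S W`
(all link derivatives of constants vanish). [folklore] -/
theorem isLuscherSeries_zero_smul {L : ℕ} [NeZero L] (B : SuBasis n) (S : AmbConfig d L n → ℝ) :
    IsLuscherSeries B (fun W => (0 : ℝ) * S W) (fun _ _ => (0 : ℝ)) (fun _ => 0) := by
  have h0 : ∀ (e : Edge d L) (X : Matrix (Fin n) (Fin n) ℂ),
      linkDeriv e X (fun _ : AmbConfig d L n => (0 : ℝ)) = fun _ => 0 :=
    fun e X => linkDeriv_const e X 0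
  have hlap : ∀ W : AmbConfig d L n, linkLap B (fun _ : AmbConfig d L n => (0 : ℝ)) W = 0 := by
    intro W
    unfold linkLap
    simp [h0]
  refine ⟨fun U => ?_, fun k U => ?_⟩
  · rw [hlap]; ring
  · rw [hlap]; simp [h0]

/-- **Lüscher's volume-uniform radius (§4.5(b)) at every coupling, from the geometric gradient bound
(ours; PROVED).** If `|∂^a_e S̃^{(k)}(ιU)| ≤ C ρ^{-k}` uniformly in the volume for the Lüscher series of the
Wilson action `S_W` (`LuscherGeometricGradientBound d n`), then for every `β` the gradient series of every
smooth Lüscher series of `β S_W` converges for `|t| < ρ/|β|` (any `t` if `β = 0`), uniformly in `L`: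
`LuscherUniformRadius d n β`. For `β ≠ 0` the series rescaled by `β^{-(k+1)}` is a Lüscher series of `S_W`
(`IsLuscherSeries.smul`), so `|∂^a_e S̃^{(k)}| ≤ |β|^{k+1} C ρ^{-k}`; for `β = 0` all gradients vanish
(`IsLuscherSeries.linkDeriv_eq` against the zero series). [cite: Luscher2010Trivializing, §4.5(b)] -/
theorem luscherUniformRadius_of_geometric (h : LuscherGeometricGradientBound d n) (β : ℝ) :
    LuscherUniformRadius d n β := by
  obtain ⟨ρ, hρ, C, hC⟩ := h
  rcases eq_or_ne β 0 with rfl | hβ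
  · refine ⟨1, one_pos, fun L _ B Sk c hsm hser t _ U e a => ?_⟩
    have hzero : ∀ k, linkDeriv e (B.T a) (Sk k) (WilsonFlow.coeConfig U) = 0 := fun k => by
      rw [(IsLuscherSeries.linkDeriv_eq hser (isLuscherSeries_zero_smul B ambWilsonAction) hsm
        (fun _ => contDiff_const) k).2 e a U]
      exact congrFun (linkDeriv_const e (B.T a) 0) _
    simp only [hzero, abs_zero, mul_zero]
    exact summable_zero
  · have hβabs : 0 < |β| := abs_pos.mpr hβ
    refine ⟨ρ / |β|, div_pos hρ hβabs, fun L _ B Sk c hsm hser t ht U e a => ?_⟩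
    have hser' : IsLuscherSeries B ambWilsonAction (fun k W => β⁻¹ ^ (k + 1) * Sk k W)
        (fun k => β⁻¹ ^ (k + 1) * c k) := by
      have h1 := hser.smul β⁻¹
      simp only [inv_mul_cancel_left₀ hβ] at h1
      exact h1
    have hsm' : ∀ k, ContDiff ℝ (⊤ : ℕ∞) (fun W : AmbConfig d L n => β⁻¹ ^ (k + 1) * Sk k W) :=
      fun k => contDiff_const.mul (hsm k)
    have hbound : ∀ k, |linkDeriv e (B.T a) (Sk k) (WilsonFlow.coeConfig U)| ≤
        |β| ^ (k + 1) * (C * ρ⁻¹ ^ k) := by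
      intro k
      have hk := hC L B _ _ hsm' hser' k U e a
      rw [linkDeriv_const_mul' e (B.T a) _ (Sk k), abs_mul, abs_pow, abs_inv] at hk
      calc |linkDeriv e (B.T a) (Sk k) (WilsonFlow.coeConfig U)|
          = |β| ^ (k + 1) * (|β|⁻¹ ^ (k + 1) * |linkDeriv e (B.T a) (Sk k) (WilsonFlow.coeConfig U)|) := by
            rw [← mul_assoc, ← mul_pow, mul_inv_cancel₀ hβabs.ne', one_pow, one_mul]
        _ ≤ |β| ^ (k + 1) * (C * ρ⁻¹ ^ k) := mul_le_mul_of_nonneg_left hk (pow_nonneg (abs_nonneg β) _)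
    have hr : |t| * |β| * ρ⁻¹ < 1 := by
      rw [← div_eq_mul_inv, div_lt_one hρ]
      exact (lt_div_iff₀ hβabs).1 ht
    refine Summable.of_nonneg_of_le (fun k => by positivity) (fun k => ?_)
      ((summable_geometric_of_lt_one (by positivity) hr).mul_left (C * |β|))
    calc |t| ^ k * |linkDeriv e (B.T a) (Sk k) (WilsonFlow.coeConfig U)|
        ≤ |t| ^ k * (|β| ^ (k + 1) * (C * ρ⁻¹ ^ k)) :=
          mul_le_mul_of_nonneg_left (hbound k) (pow_nonneg (abs_nonneg t) _)
      _ = C * |β| * (|t| * |β| * ρ⁻¹) ^ k := by rw [mul_pow, mul_pow, pow_succ]; ring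

end

end Summit.Ventures.LatticeQCDFlow.TrivializingMaps
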